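import Summits.ValiantsHypothesis.ValiantsHypothesis.Theorems.KPlusLogSqLawTropicalBToeplitzDoublingBipartite

/-!
# Route `KPlusLogSqLaw`, crux `TropicalB` — Toeplitz sector: preliminaries for the MORPH-DOUBLING law (pencil transfer, slope bookkeeping)

HONEST FRAMING.  Helper toward the registered stubs `stub_tropThin` / `stub_tropFat` (crux `…Theses.KPlusLogSqLaw.TropicalB`, item
`stmt-ValiantsHypothesis-19771`; cell `pub-symmetroid`, seat `val-sym-trop-p4` (g23), 2026-08-29).  Two small lemmas used by
`…ToeplitzDoublingMorph` to add the bottom phase (the morph members of `…ToeplitzMorphMember`) to the bipartite doubling chain of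
`…ToeplitzDoubling`:
* `pencil_transfer`: in an instance with quadratic slope `θ = −2t`, footrule reward `C = K·t` and a bounded remainder `g`
  (`|Σ_p g(δ_p)| ≤ B` for every permutation), the weight is `t·Σ_p |δ_p|(K − 2|δ_p|) + Σ_p g(δ_p)`; so if `τ` is the UNIQUE maximiser
  of the integer pencil objective `Σ |δ|(K − 2|δ|)` and `t > 2B`, then `τ` is the unique maximiser of the weight (integer margin `≥ 1`
  times `t` beats the remainder);
* `factorial_div_anti`: for `0 < K < K' ≤ N`, the exact quotients satisfy `N!/K' < N!/K` (the bottom slopes `−2t_h`,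
  `t_h = 2C₁·(3n)!/K_h`, increase with `h`).
Definition-free.  Nothing here bounds `Φ_Toep`; `ConjectureTPoly` / `TropicalB` stay OPEN; nothing on `MatrixDescartes` or `VP ≠ VNP`.
-/

set_option linter.dupNamespace false
set_option autoImplicit false

namespace Summit.ValiantsHypothesis.ValiantsHypothesis.Theorems.KPlusLogSqLaw.Toeplitz

open scoped BigOperators
open Finset

/-- **Pencil transfer.**  With slope `θ = −2t`, reward `C = K t` and remainder `g` bounded by `B` in total over every permutation,
a unique maximiser `τ` of the integer pencil objective `Σ_p |δ_p|(K − 2|δ_p|)` is the unique maximiser of the weight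
`Σ_p (θ δ_p² + (g δ_p + C|δ_p|))` as soon as `2B < t`. [folklore] -/
theorem pencil_transfer {m : ℕ} (K t B θ C : ℤ) (hθ : θ = -2 * t) (hC : C = K * t) (ht : 2 * B < t) (g : ℤ → ℤ)
    (τ : Equiv.Perm (Fin m))
    (hB : ∀ σ : Equiv.Perm (Fin m), |∑ p : Fin m, g (((σ p : Fin m) : ℤ) - (p : ℤ))| ≤ B)
    (hopt : ∀ σ : Equiv.Perm (Fin m), σ ≠ τ →
      ∑ p : Fin m, |((σ p : Fin m) : ℤ) - (p : ℤ)| * (K - 2 * |((σ p : Fin m) : ℤ) - (p : ℤ)|) <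
      ∑ p : Fin m, |((τ p : Fin m) : ℤ) - (p : ℤ)| * (K - 2 * |((τ p : Fin m) : ℤ) - (p : ℤ)|)) :
    ∀ σ : Equiv.Perm (Fin m), σ ≠ τ →
      ∑ p : Fin m, (θ * (fun δ : ℤ => δ ^ 2) (((σ p : Fin m) : ℤ) - (p : ℤ)) +
          (g (((σ p : Fin m) : ℤ) - (p : ℤ)) + C * |((σ p : Fin m) : ℤ) - (p : ℤ)|)) <
      ∑ p : Fin m, (θ * (fun δ : ℤ => δ ^ 2) (((τ p : Fin m) : ℤ) - (p : ℤ)) +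
          (g (((τ p : Fin m) : ℤ) - (p : ℤ)) + C * |((τ p : Fin m) : ℤ) - (p : ℤ)|)) := by
  intro σ hσ
  have key : ∀ ρ : Equiv.Perm (Fin m),
      ∑ p : Fin m, (θ * (fun δ : ℤ => δ ^ 2) (((ρ p : Fin m) : ℤ) - (p : ℤ)) +
          (g (((ρ p : Fin m) : ℤ) - (p : ℤ)) + C * |((ρ p : Fin m) : ℤ) - (p : ℤ)|)) =
        t * ∑ p : Fin m, |((ρ p : Fin m) : ℤ) - (p : ℤ)| * (K - 2 * |((ρ p : Fin m) : ℤ) - (p : ℤ)|) +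
          ∑ p : Fin m, g (((ρ p : Fin m) : ℤ) - (p : ℤ)) := by
    intro ρ
    rw [mul_sum, ← sum_add_distrib]
    refine sum_congr rfl fun p _ => ?_
    have hsq : (((ρ p : Fin m) : ℤ) - (p : ℤ)) ^ 2 = |((ρ p : Fin m) : ℤ) - (p : ℤ)| ^ 2 := (sq_abs _).symm
    simp only [hθ, hC, hsq]
    ring
  rw [key σ, key τ]
  have h1 := hopt σ hσ
  have h2 := hB σ
  have h3 := hB τ
  rw [abs_le] at h2 h3
  have ht0 : 0 ≤ t := by
    have := abs_nonneg (∑ p : Fin m, g (((σ p : Fin m) : ℤ) - (p : ℤ)))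
    linarith
  nlinarith

/-- **Exact factorial quotients decrease**: for `0 < K < K' ≤ N`, `N! / K' < N! / K` (both divisions are exact). [folklore] -/
theorem factorial_div_anti (N K K' : ℕ) (hK : 0 < K) (hKK' : K < K') (hK'N : K' ≤ N) :
    N.factorial / K' < N.factorial / K := by
  have hdK : K ∣ N.factorial := Nat.dvd_factorial hK (by omega)
  have hdK' : K' ∣ N.factorial := Nat.dvd_factorial (by omega) hK'N
  have e1 : K * (N.factorial / K) = N.factorial := Nat.mul_div_cancel' hdK
  have e2 : K' * (N.factorial / K') = N.factorial := Nat.mul_div_cancel' hdK'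
  have hpos : 0 < N.factorial := Nat.factorial_pos N
  by_contra hge
  push Not at hge
  have : K' * (N.factorial / K') ≥ K' * (N.factorial / K) := Nat.mul_le_mul_left _ hge
  have h2 : K' * (N.factorial / K) > K * (N.factorial / K) := by
    apply Nat.mul_lt_mul_of_pos_right hKK'
    rcases Nat.eq_zero_or_pos (N.factorial / K) with h0 | h0
    · rw [h0, mul_zero] at e1; omega
    · exact h0
  omega

/-- **The exact quotient is positive**: `0 < N!/K` for `0 < K ≤ N`. [folklore] -/
theorem factorial_div_pos (N K : ℕ) (hK : 0 < K) (hKN : K ≤ N) : 0 < N.factorial / K := by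
  have hdK : K ∣ N.factorial := Nat.dvd_factorial hK hKN
  have e1 : K * (N.factorial / K) = N.factorial := Nat.mul_div_cancel' hdK
  have hpos : 0 < N.factorial := Nat.factorial_pos N
  rcases Nat.eq_zero_or_pos (N.factorial / K) with h0 | h0
  · rw [h0, mul_zero] at e1; omega
  · exact h0

end Summit.ValiantsHypothesis.ValiantsHypothesis.Theorems.KPlusLogSqLaw.Toeplitz
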